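import Literature.NumberTheory.EllipticCurves.TianYuanZhang2017.GenusPeriodsParity
import HarnessLib
import Literature.NumberTheory.EllipticCurves.Tian2014.CongruentNumbersHeegnerPoints

/-!
# REVIEW-RUNBOOK sanity lemmas — the genus class number counts a FINITE set
# (client `bsd-monsky` of the ops review-runbook generator; §2 card `genusClassNumber`)

`Literature.NumberTheory.EllipticCurves.TianYuanZhang2017.genusClassNumber K = Nat.card {a : ClassGroup (𝓞 K) // IsSquare a}`.
Mathlib's `Nat.card` of an INFINITE type is the default `0`; here the counted type is a subtype of the class group of the ring
of integers of a number field, which Mathlib proves finite (`ClassGroup.fintypeOfAdmissibleOfFinite` → the `Fintype (ClassGroup (𝓞 K))`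
instance for number fields), so `g(K)` is the genuine number of squares in `Cl(K)` and in particular `1 ≤ g(K)` (the trivial class
is a square).

Review evidence only (topic module, closes no item); no definitions, no `sorry`, standard axioms.
-/

namespace Summit.BirchSwinnertonDyer.Rank1Residual.Runbook

open NumberField Literature.NumberTheory.EllipticCurves.TianYuanZhang2017

/-- (c) **The type `genusClassNumber` counts is FINITE** — the squares in the (finite) class group of `𝓞 K`, for every number
field `K`: the `Nat.card` is the genuine count. [folklore] -/
theorem genusClassNumber_finite (K : Type*) [Field K] [NumberField K] :
    Finite {a : ClassGroup (𝓞 K) // IsSquare a} :=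
  inferInstance

/-- `g(K) = |{squares in Cl(K)}|` as a `Fintype.card` (no default value involved). [folklore] -/
theorem genusClassNumber_eq_fintype_card (K : Type*) [Field K] [NumberField K]
    [Fintype {a : ClassGroup (𝓞 K) // IsSquare a}] :
    genusClassNumber K = Fintype.card {a : ClassGroup (𝓞 K) // IsSquare a} := by
  rw [genusClassNumber, Nat.card_eq_fintype_card]

/-- (b) **Non-triviality**: `1 ≤ g(K)` — the trivial class `1 = 1 * 1` is a square, and the count is a genuine one. [folklore] -/
theorem one_le_genusClassNumber (K : Type*) [Field K] [NumberField K] : 1 ≤ genusClassNumber K := by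
  rw [genusClassNumber]
  haveI : Nonempty {a : ClassGroup (𝓞 K) // IsSquare a} := ⟨⟨1, ⟨1, (mul_one 1).symm⟩⟩⟩
  exact Nat.one_le_iff_ne_zero.mpr Nat.card_pos.ne'

/-! ### Tian's `fourTwoCard` counts a FINITE set whenever the group is finite (review-runbook «card» side fact, 2026-09-05)

`Literature.NumberTheory.EllipticCurves.Literature.NumberTheory.EllipticCurves.Tian2014.fourTwoCard A = Nat.card {a : A // IsSquare a ∧ a ^ 2 = 1}` — `#(2𝒜 ∩ 𝒜[2])`
for a multiplicatively written abelian group `A`.  `Nat.card` of an INFINITE type is the default `0`, and for an arbitrary `A`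
the counted subtype can be infinite; it is finite as soon as `A` is (the only way the statements use it: `A = ClassGroup (𝓞 K)`,
finite for a number field `K` by Mathlib).  Both forms are recorded: under `[Finite A]`, and at the class group. -/

/-- (c) **The type `fourTwoCard A` counts is FINITE for a finite group `A`**: under `[Finite A]` the `Nat.card` is the genuine
number of squares of order dividing `2`. [folklore] -/
theorem fourTwoCard_finite (A : Type*) [CommGroup A] [Finite A] :
    Finite {a : A // IsSquare a ∧ a ^ 2 = 1} :=
  inferInstance

/-- (c) **At the class group of a number field** (Tian's `𝒜 = Cl(ℚ(√-2n))`): the counted type is finite with no further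
hypothesis, since `ClassGroup (𝓞 K)` is finite. [folklore] -/
theorem fourTwoCard_classGroup_finite (K : Type*) [Field K] [NumberField K] :
    Finite {a : ClassGroup (𝓞 K) // IsSquare a ∧ a ^ 2 = 1} :=
  inferInstance

/-- (b) **Non-triviality**: `1 ≤ fourTwoCard A` for a finite `A` — the identity `1 = 1 * 1`, `1 ^ 2 = 1` is counted, and the
count is a genuine one. [folklore] -/
theorem one_le_fourTwoCard (A : Type*) [CommGroup A] [Finite A] :
    1 ≤ Literature.NumberTheory.EllipticCurves.Tian2014.fourTwoCard A := by
  rw [Literature.NumberTheory.EllipticCurves.Tian2014.fourTwoCard]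
  haveI : Nonempty {a : A // IsSquare a ∧ a ^ 2 = 1} := ⟨⟨1, ⟨1, (mul_one 1).symm⟩, one_pow 2⟩⟩
  exact Nat.one_le_iff_ne_zero.mpr Nat.card_pos.ne'

/-! ### The improper integral in the authors' real period `Ω_{n,∞}` CONVERGES (review-runbook «integral» side fact, 2026-09-05)

`realPeriodTYZ n = 2 / √n * ∫ x in Set.Ioi 1, 1 / √(x³ − x)` (Tian–Yuan–Zhang, §1).  Mathlib's Bochner integral of a
NON-integrable function is the default `0`; the docstring asserts «the integrand is integrable» — here is the kernel form:
near `x = 1` the integrand is `≤ (x − 1)^{-1/2}` (since `x³ − x = (x−1)·x·(x+1) ≥ x − 1` on `[1, 2]`), and for `x ≥ 2` it is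
`≤ √2 · x^{-3/2}` (since `x³ − x ≥ x³/2` there); both majorants are integrable. -/

/-- Near the endpoint: `1/√(x³ − x) ≤ (x − 1)^{-1/2}` for `1 < x ≤ 2`. [folklore] -/
theorem tyz_integrand_le_near_one {x : ℝ} (hx : x ∈ Set.Ioc (1 : ℝ) 2) :
    1 / Real.sqrt (x ^ 3 - x) ≤ (x - 1) ^ (-(1 / 2 : ℝ)) := by
  have h1 : 0 < x - 1 := by linarith [hx.1]
  have h3 : x - 1 ≤ x ^ 3 - x := by
    have e : x ^ 3 - x - (x - 1) = (x - 1) * (x ^ 2 + x - 1) := by ring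
    have : 0 ≤ (x - 1) * (x ^ 2 + x - 1) := mul_nonneg h1.le (by nlinarith [hx.1])
    linarith
  calc 1 / Real.sqrt (x ^ 3 - x) ≤ 1 / Real.sqrt (x - 1) :=
        one_div_le_one_div_of_le (Real.sqrt_pos.2 h1) (Real.sqrt_le_sqrt h3)
    _ = (x - 1) ^ (-(1 / 2 : ℝ)) := by
        rw [Real.sqrt_eq_rpow, Real.rpow_neg h1.le, one_div]

/-- At infinity: `1/√(x³ − x) ≤ √2 · x^{-3/2}` for `x > 2`. [folklore] -/
theorem tyz_integrand_le_far {x : ℝ} (hx : x ∈ Set.Ioi (2 : ℝ)) :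
    1 / Real.sqrt (x ^ 3 - x) ≤ Real.sqrt 2 * x ^ (-(3 / 2 : ℝ)) := by
  have h2 : 2 < x := hx
  have hx0 : 0 < x := by linarith
  have h3 : x ^ 3 / 2 ≤ x ^ 3 - x := by
    have e : x ^ 3 - x - x ^ 3 / 2 = x * (x ^ 2 - 2) / 2 := by ring
    have : 0 ≤ x * (x ^ 2 - 2) / 2 := by
      have : 0 ≤ x ^ 2 - 2 := by nlinarith
      positivity
    linarith
  have hpos : 0 < x ^ 3 / 2 := by positivity
  calc 1 / Real.sqrt (x ^ 3 - x) ≤ 1 / Real.sqrt (x ^ 3 / 2) :=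
        one_div_le_one_div_of_le (Real.sqrt_pos.2 hpos) (Real.sqrt_le_sqrt h3)
    _ = Real.sqrt 2 * x ^ (-(3 / 2 : ℝ)) := by
        rw [Real.sqrt_div' _ zero_le_two, Real.sqrt_eq_rpow (x ^ 3), ← Real.rpow_natCast x 3,
          ← Real.rpow_mul hx0.le, Real.rpow_neg hx0.le]
        norm_num
        rw [div_eq_mul_inv]

/-- (c) **The integrand of `realPeriodTYZ` is integrable on `(1, ∞)`**: the Bochner integral `∫ x in Set.Ioi 1, 1 / √(x³ − x)`
is a genuine (convergent, improper) integral, not the non-integrable default `0` — for every `n`. [folklore] -/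
theorem realPeriodTYZ_integrand_integrableOn :
    MeasureTheory.IntegrableOn (fun x : ℝ => 1 / Real.sqrt (x ^ 3 - x)) (Set.Ioi 1) := by
  have hcont : ContinuousOn (fun x : ℝ => 1 / Real.sqrt (x ^ 3 - x)) (Set.Ioi 1) := by
    refine ContinuousOn.div continuousOn_const ((continuous_pow 3).sub continuous_id).sqrt.continuousOn ?_
    intro x hx
    have h1 : (1:ℝ) < x := hx
    have : 0 < x ^ 3 - x := by
      have e : x ^ 3 - x = x * (x - 1) * (x + 1) := by ring
      rw [e]
      exact mul_pos (mul_pos (by linarith) (by linarith)) (by linarith)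
    exact (Real.sqrt_pos.2 this).ne'
  rw [← Set.Ioc_union_Ioi_eq_Ioi (show (1:ℝ) ≤ 2 by norm_num)]
  refine MeasureTheory.IntegrableOn.union ?_ ?_
  · have hg : MeasureTheory.IntegrableOn (fun x : ℝ => (x - 1) ^ (-(1 / 2 : ℝ))) (Set.Ioc 1 2) := by
      have h := (intervalIntegral.intervalIntegrable_rpow' (a := 0) (b := 1)
        (show -1 < -(1 / 2 : ℝ) by norm_num)).comp_sub_right 1
      have h' : IntervalIntegrable (fun x : ℝ => (x - 1) ^ (-(1 / 2 : ℝ))) MeasureTheory.volume 1 2 := by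
        convert h using 1 <;> norm_num
      exact (intervalIntegrable_iff_integrableOn_Ioc_of_le (show (1:ℝ) ≤ 2 by norm_num)).1 h'
    refine MeasureTheory.Integrable.mono' hg
      ((hcont.mono Set.Ioc_subset_Ioi_self).aestronglyMeasurable measurableSet_Ioc) ?_
    refine (MeasureTheory.ae_restrict_iff' measurableSet_Ioc).2 (Filter.Eventually.of_forall fun x hx => ?_)
    rw [Real.norm_eq_abs, abs_of_nonneg (by positivity)]
    exact tyz_integrand_le_near_one hx
  · have hg : MeasureTheory.IntegrableOn (fun x : ℝ => Real.sqrt 2 * x ^ (-(3 / 2 : ℝ))) (Set.Ioi 2) :=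
      (integrableOn_Ioi_rpow_of_lt (show (-(3 / 2 : ℝ)) < -1 by norm_num) two_pos).const_mul _
    refine MeasureTheory.Integrable.mono' hg
      ((hcont.mono (Set.Ioi_subset_Ioi (by norm_num))).aestronglyMeasurable measurableSet_Ioi) ?_
    refine (MeasureTheory.ae_restrict_iff' measurableSet_Ioi).2 (Filter.Eventually.of_forall fun x hx => ?_)
    rw [Real.norm_eq_abs, abs_of_nonneg (by positivity)]
    exact tyz_integrand_le_far hx

end Summit.BirchSwinnertonDyer.Rank1Residual.Runbook
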